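import Literature.MathematicalPhysics.QuantumFieldTheory.Balaban1983to89.Beta.StepDriftWitness
import Summits.QuantumFields.BalabanUV.Beta.HessKerConvCKPlug
/-!
# `BalabanUV.Beta.HessKerSlotCurrency` — the CURRENCY LADDER for the S- and W-slots of the one-step wall family, every bridge kernel-checked
# BY NAME on tree theorems, and the SPLIT WALL SOCKET «drift ⟺ identification ⟸ two HALF-KERNEL letters» (part A: generic; part B =
# `HessKerSlotCurrencyRowD1`, the instance at the literal of record `RowD1JointEnd.JsRowD1`).  asym1 GEN 52 (author: template author of
# `HessKerFourFamily` ∕ `HessKerCoDressedBmWall(Rec)`; unit `b2b-balaban-beta-asym1-g52`) — filed by courier `b2b-balaban-beta-lit1-g31`;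
# answers gan24-p1-g13's RECOMMENDED REPAIR (iv) (journal l.19006) and ref2 RULING R119-2 (l.19303, items (α) binder shape ∕ (β) socket theorem).

HONEST DEPENDENCY (page 1, mandatory): continuum YM on T⁴ ⇐ BetaPertH ∧ nine spine estimates (0/9 proved); BetaPertH ⇐ (D1) ∧ (D4) ∧
CAP+tail; G-an2-4 gates asym, D1 and NE2/3/4.  HONEST FRAMING (cell contract, verbatim): «discharging `BetaPertH` makes Bałaban's UV
stability UNCONDITIONAL — a real constructive-QFT result; it is NOT the continuum limit and NOT the Clay problem.»  THIS MODULE is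
bookkeeping ∕ plumbing ([folklore] kernel algebra + composition BY NAME of tree theorems): no `def`, no `def … : Prop`, nothing cited as a
fact, 0 sorry; EVERY row ∕ letter of every END below is a HYPOTHESIS SHAPE, universally bound, never asserted for Bałaban's objects; the module
discharges NOTHING of `BetaPertH`: NOT an estimate, NOT D1, NEVER «G-an2-4 closed», NOT (CONV-C), NOT BetaPertH, NOT continuum, NOT Clay.
ABSOLUTE RULE (cell charter, verbatim): «No internally-minted statement may enter as a cited fact. Every hypothesis is either kernel-proved in
this package or a verbatim quotation of a PUBLISHED theorem with page reference. The manuscript(s) under audit are NOT citable for their own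
disputed steps — they are the thing under adjudication; programme-internal (2001/route/tribunal) claims are never citable.»

WHY.  The wall ENDs of record (`HessKerFourFamily.d1Drift_iff_of_cauchy_four`; road FP's `FP.RoadEndGeneric`; the template
`HessKerCoDressedBmWall(Rec)` §3) take the S-slot rows ENTRYWISE (`LocStencil` of the unit-rescaled stencil tables) and the W-slot rows ENTRYWISE
(`VertexFamily₂` of the unit-rescaled tables).  The row owner's ENGINE «SREC-DIFF» (diag-only numerics) reports that for the recursive literal (E)
the entrywise tables do not converge while the PAIRED quantities the drift proof evaluates do, and asks (repair (iv)) for slot hypotheses «in a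
TEST-FORM currency».  The drift proof sees `S_j` ONLY through the assembled vertex `V_j := vertexOfK G_j Lc S_j` inside the BUBBLE
`Tr[(G_j∘V_j^μ(0))(G_j∘V_j^ν(z))]` and `W_j` ONLY through the TADPOLE `Tr[G_j ∘ W_j^{μν}(0,z)]`.  The LADDER (each rung implied by the one above by
a NAMED tree theorem): L0 ENTRYWISE (today's binders) ⟹ L1 VERTEX rows `VertexFamily(W)` on `V_j` (`HessKerSchur.vertexFamilyW_vertexOfK`,
`HessKerSchurCauchy.vertexFamilyW_vertexOfK_allScales`) ⟹ L2 HALF-KERNEL letters `LimitRate.UniformDecay` + `HessKerSchurCauchy.AllScalesRate` of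
the S-HALF `j ↦ hessKer G_j V_j 0` (= `−½·bubble`, `hessKer_zeroW`) and the W-HALF `j ↦ hessKer G_j 0 W_j` (= `½·tadpole`, `hessKer_zeroV`), every
leg paired, UNIT-FREE (`HessKerFourFamily.hessKer_four_unit`) (`HessKerSchur.uniformDecay_hessKer_halfV`, `HessKerSchurCauchy.allScalesRate_hessKer_halfV`
with the other slot `:= 0`) ⟹ L3 MOMENT letters `RemainderConstAllScales.AllScalesSeq` (`allScalesSeq_secondMoment`) ⟹ the socket
`HessKerDressedCauchy.d1Drift_iff_lim_eq`.
CONTENT.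
* §1 [folklore] half-kernel algebra: `hessKer A V W = hessKer A 0 W + hessKer A V 0` pointwise; the zero families lie in every class.
* §2 [folklore] `AllScalesSeq` ∕ `AllScalesRate` ∕ `UniformDecay` algebra (sum; raising the rate ∕ constant — for merging rows of different rates);
  `lim_secondMoment_eq_limKernelOf` (the two L2 letters identify the Cauchy limit of the moment sequence with the moment of the limit kernel).
* §3 THE SPLIT WALL SOCKET, ANY `Js : ℕ → JetData 3 Lc` with a three-family closed form `T_j = hessKer A_j V_j W_j`:
  **`d1Drift_iff_lim_eq_of_halves_seq`** (L3 letters), **`d1Drift_iff_of_halfKernel_letters`** (L2 letters; the limit VALUE is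
  `secondMoment (limKernelOf W-half) + secondMoment (limKernelOf S-half)`), **`d1Drift_iff_of_kernel_letters`** (one joint L2 letter on `T_j` itself).
* §4 SUPPLIERS down the ladder (generic `D`, `F`): W-half L2 letters ⟸ weighted ∕ entrywise K- and W-rows; S-half L2 letters ⟸ weighted ∕
  entrywise K-rows and VERTEX rows (L1); vertex rows ⟸ stencil rows (L0) BY NAME; rate-merging of vertex rows.
WHAT IS NOT HERE: which rung Bałaban's recursive stencils ∕ tables actually satisfy (row owner gan24-p1 ∕ an2); any estimate; the identification
of the limit value with `stepBal` (road FP ∕ D1 level); the instance at the literal (part B `HessKerSlotCurrencyRowD1`).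
-/
noncomputable section

namespace Summit.QuantumFields.BalabanUV.Beta.HessKerSlotCurrency

open Finset Filter Topology
open scoped BigOperators
open Literature.MathematicalPhysics.QuantumFieldTheory.Balaban1983to89
open Literature.MathematicalPhysics.QuantumFieldTheory.Balaban1983to89.Beta
open B12Sec2to5 (Decay510 betaPrime510 secondMoment_abs_le_of_decay510)
open B12Beta (secondMoment)
open B12Normalization (stepBal)
open ExpKernelCalculus (MKer Decays BiLoc VertexFamily VertexFamily₂ hessKer tadpole bubble comp tr Zl)
open LimitRate (UniformDecay GeometricRate StepRate limKernelOf subKernel)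
open HessKerRate (biLoc_zero)
open HessKerSchur (ColW BiW VertexFamilyW VertexFamily₂W hessW lipW LocStencilW colW_of_decays locStencilW_of_locStencil
  vertexFamilyW_of_vertexFamily vertexFamily₂W_of_vertexFamily₂ uniformDecay_hessKer_halfV vertexFamilyW_vertexOfK)
open HessKerSchurCauchy (AllScalesRate allScalesRate_hessKer_halfV vertexFamilyW_vertexOfK_allScales)
open RemainderConstAllScales (AllScalesSeq allScalesSeq_secondMoment allScalesSeq_secondMoment_of_summable)
open RateCertificate (GeomRate CauchyRate)
open OneStepResolventKernel (Fib LocStencil JetData)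
open OneStepKernelFamily (vertexOfK KInvStep TbalOf D1Drift)
open HessKerDressedCauchy (d1Drift_iff_lim_eq one_le_Lc)
open Summit.QuantumFields.BalabanUV.Beta.HessKerConvCKPlug (biLoc_mono')

/-! ## §1 Half-kernel algebra: the one-step kernel is the sum of its tadpole half and its bubble half; zero families lie in every class -/

section Half

variable {D : ℕ} {F : Type*} [Fintype F]

/-- [folklore] **THE W-HALF (TADPOLE HALF)**: `hessKer A 0 W μ ν z = ½·Tr[A ∘ W^{μν}(0,z)]`. -/
theorem hessKer_zeroV (A : MKer D F) (W : Fin D → (Fin D → ℤ) → Fin D → (Fin D → ℤ) → MKer D F) (μ ν : Fin D) (z : Fin D → ℤ) :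
    hessKer A 0 W μ ν z = 1 / 2 * tadpole A (W μ 0 ν z) := by
  simp only [hessKer, Pi.zero_apply, StepDriftWitness.bubble_zero, mul_zero, sub_zero]

/-- [folklore] **THE S-HALF (BUBBLE HALF)**: `hessKer A V 0 μ ν z = −½·Tr[(A∘V^μ(0))(A∘V^ν(z))]`. -/
theorem hessKer_zeroW (A : MKer D F) (V : Fin D → (Fin D → ℤ) → MKer D F) (μ ν : Fin D) (z : Fin D → ℤ) :
    hessKer A V 0 μ ν z = -(1 / 2 * bubble A (V μ 0) (V ν z)) := by
  simp only [hessKer, Pi.zero_apply, StepDriftWitness.tadpole_zero, mul_zero, zero_sub]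

/-- [folklore] **THE ONE-STEP KERNEL IS THE SUM OF ITS TWO HALVES**, pointwise: `hessKer A V W = hessKer A 0 W + hessKer A V 0`. -/
theorem hessKer_eq_halfW_add_halfS (A : MKer D F) (V : Fin D → (Fin D → ℤ) → MKer D F)
    (W : Fin D → (Fin D → ℤ) → Fin D → (Fin D → ℤ) → MKer D F) (μ ν : Fin D) (z : Fin D → ℤ) :
    hessKer A V W μ ν z = hessKer A 0 W μ ν z + hessKer A V 0 μ ν z := by
  rw [hessKer_zeroV, hessKer_zeroW]
  simp only [hessKer]
  ring

/-- [folklore] The second moment splits accordingly (both halves absolutely convergent). -/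
theorem secondMoment_eq_halves {A : MKer D F} {V : Fin D → (Fin D → ℤ) → MKer D F}
    {W : Fin D → (Fin D → ℤ) → Fin D → (Fin D → ℤ) → MKer D F} {μ ν : Fin D}
    (hsW : Summable fun z : Fin D → ℤ => hessKer A 0 W μ ν z * (z μ : ℝ) * (z ν : ℝ))
    (hsS : Summable fun z : Fin D → ℤ => hessKer A V 0 μ ν z * (z μ : ℝ) * (z ν : ℝ)) :
    secondMoment (hessKer A V W) μ ν = secondMoment (hessKer A 0 W) μ ν + secondMoment (hessKer A V 0) μ ν := by
  unfold B12Beta.secondMoment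
  rw [← hsW.tsum_add hsS]
  refine tsum_congr fun z => ?_
  rw [hessKer_eq_halfW_add_halfS]
  ring

/-- [folklore] The zero kernel is in every weighted bi-localisation class with a nonnegative bound. -/
theorem biW_zero (p q : Fin D → ℤ) (R : ℝ) {B : ℝ} (hB : 0 ≤ B) : BiW (0 : MKer D F) p q R B := by
  intro s t
  simpa using hB

/-- [folklore] The zero first-order vertex family is in every weighted class with a nonnegative bound. -/
theorem vertexFamilyW_zero (N : ℕ) (R : ℝ) {B : ℝ} (hB : 0 ≤ B) : VertexFamilyW (0 : Fin D → (Fin D → ℤ) → MKer D F) N R B :=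
  fun _ _ => biW_zero _ _ R hB

/-- [folklore] The zero second-order table family is in every weighted class with a nonnegative bound. -/
theorem vertexFamily₂W_zero (N : ℕ) (R : ℝ) {B : ℝ} (hB : 0 ≤ B) :
    VertexFamily₂W (0 : Fin D → (Fin D → ℤ) → Fin D → (Fin D → ℤ) → MKer D F) N R B :=
  fun _ _ _ _ => biW_zero _ _ R hB

omit [Fintype F] in
/-- [folklore] The zero first-order vertex family is an (unweighted) vertex family with constant `0`, any rate. -/
theorem vertexFamily_zero (N : ℕ) (δ : ℝ) : VertexFamily (0 : Fin D → (Fin D → ℤ) → MKer D F) N 0 δ :=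
  fun _ _ => biLoc_zero _ _ δ

omit [Fintype F] in
/-- [folklore] The zero second-order table family is an (unweighted) table family with constant `0`, any rate. -/
theorem vertexFamily₂_zero (N : ℕ) (δ : ℝ) : VertexFamily₂ (0 : Fin D → (Fin D → ℤ) → Fin D → (Fin D → ℤ) → MKer D F) N 0 δ :=
  fun _ _ _ _ => biLoc_zero _ _ δ

end Half

/-! ## §2 Sequence ∕ kernel-rate algebra: sums; raising a rate or a constant (merging letters stated at different rates) -/

section Algebra

variable {D : ℕ}

/-- [folklore] All-scales bounds add. -/
theorem allScalesSeq_add {b₁ b₂ : ℕ → ℝ} {κ₁ κ₂ θ : ℝ} (h₁ : AllScalesSeq b₁ κ₁ θ) (h₂ : AllScalesSeq b₂ κ₂ θ) :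
    AllScalesSeq (fun k => b₁ k + b₂ k) (κ₁ + κ₂) θ := fun k j => by
  have e : b₁ (k + j) + b₂ (k + j) - (b₁ k + b₂ k) = (b₁ (k + j) - b₁ k) + (b₂ (k + j) - b₂ k) := by ring
  rw [e, add_mul]
  exact (abs_add_le _ _).trans (add_le_add (h₁ k j) (h₂ k j))

/-- [folklore] An all-scales kernel letter at rate `θ′ ≤ θ` (`0 ≤ θ′`) is one at rate `θ`. -/
theorem allScalesRate_mono_rate {P : ℕ → B12Beta.Kernel D} {μ ν : Fin D} {C' δ' θ' θ : ℝ} (h : AllScalesRate P μ ν C' δ' θ')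
    (hθ'0 : 0 ≤ θ') (hθ : θ' ≤ θ) : AllScalesRate P μ ν C' δ' θ := fun k j x =>
  (h k j x).trans (mul_le_mul_of_nonneg_right (mul_le_mul_of_nonneg_left (pow_le_pow_left₀ hθ'0 hθ k) h.const_nonneg)
    (Real.exp_pos _).le)

/-- [folklore] An all-scales scalar bound at rate `θ′ ≤ θ` (`0 ≤ θ′`) is one at rate `θ`. -/
theorem allScalesSeq_mono_rate {b : ℕ → ℝ} {κ θ' θ : ℝ} (h : AllScalesSeq b κ θ') (hθ'0 : 0 ≤ θ') (hθ : θ' ≤ θ) :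
    AllScalesSeq b κ θ := fun k j =>
  (h k j).trans (mul_le_mul_of_nonneg_left (pow_le_pow_left₀ hθ'0 hθ k) h.const_nonneg)

/-- [folklore] **THE LIMIT VALUE IN HALF-KERNEL CURRENCY**: under a uniform letter and an all-scales letter (`δ, δ′ > 0`, `0 ≤ θ < 1`) the
constructed limit of the second moments IS the second moment of the telescoped limit kernel `limKernelOf P`
(`HessKerSchurCauchy.AllScalesRate.stepRate` + `LimitRate.StepRate.geometricRate` + `LimitRate.tendsto_secondMoment` + uniqueness of limits). -/
theorem lim_secondMoment_eq_limKernelOf {P : ℕ → B12Beta.Kernel D} {μ ν : Fin D} {C δ C' δ' θ : ℝ} (hU : UniformDecay P μ ν C δ)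
    (hA : AllScalesRate P μ ν C' δ' θ) (hδ : 0 < δ) (hδ' : 0 < δ') (hθ0 : 0 ≤ θ) (hθ1 : θ < 1) :
    CauchyRate.lim (fun k => secondMoment (P k) μ ν) = secondMoment (limKernelOf P) μ ν :=
  ((allScalesSeq_secondMoment hU hA hδ hδ').cauchyRate.eq_lim hθ1
    (LimitRate.tendsto_secondMoment hU (hA.stepRate.geometricRate hθ0 hθ1) hδ hδ' hθ0 hθ1)).symm

end Algebra

/-! ## §3 THE SPLIT WALL SOCKET: drift ⟺ identification, from one letter per half, in moment (L3) or half-kernel (L2) currency -/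

section SocketGeneric

variable {D : ℕ} {F : Type*} [Fintype F] {A : ℕ → MKer D F} {V : ℕ → Fin D → (Fin D → ℤ) → MKer D F}
  {W : ℕ → Fin D → (Fin D → ℤ) → Fin D → (Fin D → ℤ) → MKer D F} {μ ν : Fin D}

/-- [folklore] **L3 JOIN**: all-scales bounds of the two half second-moment sequences (each half absolutely convergent at every level) give the
all-scales bound of the full second moments, constants added. -/
theorem allScalesSeq_secondMoment_of_halves_seq {κW κS θ : ℝ}
    (hsW : ∀ j, Summable fun z : Fin D → ℤ => hessKer (A j) 0 (W j) μ ν z * (z μ : ℝ) * (z ν : ℝ))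
    (hsS : ∀ j, Summable fun z : Fin D → ℤ => hessKer (A j) (V j) 0 μ ν z * (z μ : ℝ) * (z ν : ℝ))
    (hW : AllScalesSeq (fun j => secondMoment (hessKer (A j) 0 (W j)) μ ν) κW θ)
    (hS : AllScalesSeq (fun j => secondMoment (hessKer (A j) (V j) 0) μ ν) κS θ) :
    AllScalesSeq (fun j => secondMoment (hessKer (A j) (V j) (W j)) μ ν) (κW + κS) θ :=
  (allScalesSeq_add hW hS).congr fun j => secondMoment_eq_halves (hsW j) (hsS j)

/-- [folklore] **L2 JOIN**: a uniform + an all-scales HALF-KERNEL letter per half (`δ`'s `> 0`) give the all-scales bound of the full second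
moments with `κ = β′(c_W, δ_W′) + β′(c_S, δ_S′)` EXPLICIT (`RemainderConstAllScales.allScalesSeq_secondMoment` per half).  NO range of `θ`. -/
theorem allScalesSeq_secondMoment_of_halves {CW δW cW δW' CS δS cS δS' θ : ℝ}
    (hWu : UniformDecay (fun j => hessKer (A j) 0 (W j)) μ ν CW δW) (hWa : AllScalesRate (fun j => hessKer (A j) 0 (W j)) μ ν cW δW' θ)
    (hSu : UniformDecay (fun j => hessKer (A j) (V j) 0) μ ν CS δS) (hSa : AllScalesRate (fun j => hessKer (A j) (V j) 0) μ ν cS δS' θ)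
    (hδW : 0 < δW) (hδW' : 0 < δW') (hδS : 0 < δS) (hδS' : 0 < δS') :
    AllScalesSeq (fun j => secondMoment (hessKer (A j) (V j) (W j)) μ ν) (betaPrime510 D cW δW' + betaPrime510 D cS δS') θ :=
  allScalesSeq_secondMoment_of_halves_seq (fun j => hWu.summable hδW j) (fun j => hSu.summable hδS j)
    (allScalesSeq_secondMoment hWu hWa hδW hδW') (allScalesSeq_secondMoment hSu hSa hδS hδS')

end SocketGeneric

section SocketWall

variable {Lc : ℕ} [NeZero Lc] (Js : ℕ → JetData 3 Lc) {A : ℕ → MKer (3 + 1) (Fib 3)}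
  {V : ℕ → Fin (3 + 1) → (Fin (3 + 1) → ℤ) → MKer (3 + 1) (Fib 3)}
  {W : ℕ → Fin (3 + 1) → (Fin (3 + 1) → ℤ) → Fin (3 + 1) → (Fin (3 + 1) → ℤ) → MKer (3 + 1) (Fib 3)} {μ ν : Fin 4}

/-- [folklore] **EXISTENCE SIDE IN HALF-KERNEL CURRENCY**: the two L2 letters per half give the all-scales bound of the wall's second-moment
sequence `j ↦ Σ_z z_μ z_ν T_j(z)` — the `(hb0, hball)`-shape letter road FP ∕ BF-x consume (`∃ κ θ, AllScalesSeq b κ θ`), constant explicit. -/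
theorem allScalesSeq_secondMoment_TbalOf_of_halves (hT : ∀ j, TbalOf Lc Js j = hessKer (A j) (V j) (W j)) {CW δW cW δW' CS δS cS δS' θ : ℝ}
    (hWu : UniformDecay (fun j => hessKer (A j) 0 (W j)) μ ν CW δW) (hWa : AllScalesRate (fun j => hessKer (A j) 0 (W j)) μ ν cW δW' θ)
    (hSu : UniformDecay (fun j => hessKer (A j) (V j) 0) μ ν CS δS) (hSa : AllScalesRate (fun j => hessKer (A j) (V j) 0) μ ν cS δS' θ)
    (hδW : 0 < δW) (hδW' : 0 < δW') (hδS : 0 < δS) (hδS' : 0 < δS') :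
    AllScalesSeq (fun j => secondMoment (TbalOf Lc Js j) μ ν) (betaPrime510 (3 + 1) cW δW' + betaPrime510 (3 + 1) cS δS') θ :=
  (allScalesSeq_secondMoment_of_halves hWu hWa hSu hSa hδW hδW' hδS hδS').congr fun j => by rw [hT j]

/-- [folklore] **THE SPLIT WALL SOCKET, L3 (MOMENT) LETTERS.**  For ANY step jet data `Js : ℕ → JetData 3 Lc` whose wall kernels have a
three-family closed form `hT : TbalOf Lc Js j = hessKer (A j) (V j) (W j)`: an all-scales bound of the W-HALF second moments and one of the
S-HALF second moments (same rate `θ`, `0 ≤ θ < 1`; each half absolutely convergent at every level) give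
`D1Drift Lc Js N μ ν ↔ lim_j Σ_z z_μ z_ν T_j(z) = stepBal N Lc` (`HessKerDressedCauchy.d1Drift_iff_lim_eq` on the L3 join). -/
theorem d1Drift_iff_lim_eq_of_halves_seq (hT : ∀ j, TbalOf Lc Js j = hessKer (A j) (V j) (W j)) {κW κS θ : ℝ}
    (hsW : ∀ j, Summable fun z : Fin (3 + 1) → ℤ => hessKer (A j) 0 (W j) μ ν z * (z μ : ℝ) * (z ν : ℝ))
    (hsS : ∀ j, Summable fun z : Fin (3 + 1) → ℤ => hessKer (A j) (V j) 0 μ ν z * (z μ : ℝ) * (z ν : ℝ))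
    (hW : AllScalesSeq (fun j => secondMoment (hessKer (A j) 0 (W j)) μ ν) κW θ)
    (hS : AllScalesSeq (fun j => secondMoment (hessKer (A j) (V j) 0) μ ν) κS θ) (hθ0 : 0 ≤ θ) (hθ1 : θ < 1) (N : ℝ) :
    D1Drift Lc Js N μ ν ↔ CauchyRate.lim (fun j => secondMoment (TbalOf Lc Js j) μ ν) = stepBal N Lc :=
  d1Drift_iff_lim_eq Js ((allScalesSeq_secondMoment_of_halves_seq hsW hsS hW hS).congr fun j => by rw [hT j]) hθ0 hθ1 N

/-- [folklore] … and the limit VALUE is the sum of the two half limits. -/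
theorem lim_secondMoment_eq_add_of_halves_seq (hT : ∀ j, TbalOf Lc Js j = hessKer (A j) (V j) (W j)) {κW κS θ : ℝ}
    (hsW : ∀ j, Summable fun z : Fin (3 + 1) → ℤ => hessKer (A j) 0 (W j) μ ν z * (z μ : ℝ) * (z ν : ℝ))
    (hsS : ∀ j, Summable fun z : Fin (3 + 1) → ℤ => hessKer (A j) (V j) 0 μ ν z * (z μ : ℝ) * (z ν : ℝ))
    (hW : AllScalesSeq (fun j => secondMoment (hessKer (A j) 0 (W j)) μ ν) κW θ)
    (hS : AllScalesSeq (fun j => secondMoment (hessKer (A j) (V j) 0) μ ν) κS θ) (hθ1 : θ < 1) :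
    CauchyRate.lim (fun j => secondMoment (TbalOf Lc Js j) μ ν) =
      CauchyRate.lim (fun j => secondMoment (hessKer (A j) 0 (W j)) μ ν) +
        CauchyRate.lim (fun j => secondMoment (hessKer (A j) (V j) 0) μ ν) := by
  have hall := (allScalesSeq_secondMoment_of_halves_seq hsW hsS hW hS).congr (b' := fun j => secondMoment (TbalOf Lc Js j) μ ν)
    fun j => by rw [hT j]
  refine (hall.cauchyRate.eq_lim hθ1 (((hW.tendsto_lim hθ1).add (hS.tendsto_lim hθ1)).congr fun j => ?_)).symm
  rw [hT j, secondMoment_eq_halves (hsW j) (hsS j)]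

/-- [folklore] **THE SPLIT WALL SOCKET, L2 (HALF-KERNEL) LETTERS — THE PROPOSED BINDER SHAPE (α) WITH ITS SOCKET THEOREM (β).**  For ANY `Js`
with a three-family closed form `hT`: a uniform letter `UniformDecay` and an all-scales letter `AllScalesRate` of the W-HALF `j ↦ hessKer (A j) 0 (W j)`
(`= ½·tadpole`) and of the S-HALF `j ↦ hessKer (A j) (V j) 0` (`= −½·bubble`) in the `(μ,ν)` component, `δ`'s `> 0`, same rate `0 ≤ θ < 1`, give
`D1Drift Lc Js N μ ν ↔ secondMoment (limKernelOf W-half) μ ν + secondMoment (limKernelOf S-half) μ ν = stepBal N Lc` — the limit VALUE named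
through the two telescoped limit HALF-KERNELS (`LimitRate.limKernelOf`), no limit table, no limit stencil, no units. -/
theorem d1Drift_iff_of_halfKernel_letters (hT : ∀ j, TbalOf Lc Js j = hessKer (A j) (V j) (W j)) {CW δW cW δW' CS δS cS δS' θ : ℝ}
    (hWu : UniformDecay (fun j => hessKer (A j) 0 (W j)) μ ν CW δW) (hWa : AllScalesRate (fun j => hessKer (A j) 0 (W j)) μ ν cW δW' θ)
    (hSu : UniformDecay (fun j => hessKer (A j) (V j) 0) μ ν CS δS) (hSa : AllScalesRate (fun j => hessKer (A j) (V j) 0) μ ν cS δS' θ)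
    (hδW : 0 < δW) (hδW' : 0 < δW') (hδS : 0 < δS) (hδS' : 0 < δS') (hθ0 : 0 ≤ θ) (hθ1 : θ < 1) (N : ℝ) :
    D1Drift Lc Js N μ ν ↔
      secondMoment (limKernelOf fun j => hessKer (A j) 0 (W j)) μ ν + secondMoment (limKernelOf fun j => hessKer (A j) (V j) 0) μ ν =
        stepBal N Lc := by
  have hsW := fun j => hWu.summable hδW j
  have hsS := fun j => hSu.summable hδS j
  have hW := allScalesSeq_secondMoment hWu hWa hδW hδW'
  have hS := allScalesSeq_secondMoment hSu hSa hδS hδS'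
  rw [d1Drift_iff_lim_eq_of_halves_seq Js hT hsW hsS hW hS hθ0 hθ1 N, lim_secondMoment_eq_add_of_halves_seq Js hT hsW hsS hW hS hθ1,
    lim_secondMoment_eq_limKernelOf hWu hWa hδW hδW' hθ0 hθ1, lim_secondMoment_eq_limKernelOf hSu hSa hδS hδS' hθ0 hθ1]

/-- [folklore] **THE UNSPLIT L2 FORM** (for comparison): ONE uniform + ONE all-scales letter on the wall kernels `T_j = TbalOf Lc Js j` themselves
give `D1Drift Lc Js N μ ν ↔ secondMoment (limKernelOf T) μ ν = stepBal N Lc` — three tree theorems composed; no closed form needed. -/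
theorem d1Drift_iff_of_kernel_letters {C δ C' δ' θ : ℝ} (hU : UniformDecay (fun j => TbalOf Lc Js j) μ ν C δ)
    (hA : AllScalesRate (fun j => TbalOf Lc Js j) μ ν C' δ' θ) (hδ : 0 < δ) (hδ' : 0 < δ') (hθ0 : 0 ≤ θ) (hθ1 : θ < 1) (N : ℝ) :
    D1Drift Lc Js N μ ν ↔ secondMoment (limKernelOf fun j => TbalOf Lc Js j) μ ν = stepBal N Lc := by
  rw [d1Drift_iff_lim_eq Js (allScalesSeq_secondMoment hU hA hδ hδ') hθ0 hθ1 N, lim_secondMoment_eq_limKernelOf hU hA hδ hδ' hθ0 hθ1]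

end SocketWall

/-! ## §4 SUPPLIERS down the ladder (generic `D`, `F`): who proves a letter in a STRONGER currency has proved it in every weaker one -/

section Suppliers

variable {D : ℕ} {F : Type*} [Fintype F] {A : ℕ → MKer D F} {V : ℕ → Fin D → (Fin D → ℤ) → MKer D F}
  {W : ℕ → Fin D → (Fin D → ℤ) → Fin D → (Fin D → ℤ) → MKer D F} {N : ℕ} {R BA BV BW cA cV cW θ : ℝ}

/-- [folklore] **W-HALF, UNIFORM LETTER ⟸ WEIGHTED K- AND W-ROWS** (`HessKerSchur.uniformDecay_hessKer_halfV` with the vertex slot `:= 0`). -/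
theorem uniformDecay_halfW (hA : ∀ j, ColW (A j) R BA) (hW : ∀ j, VertexFamily₂W (W j) N R BW) (hR : 0 ≤ R) (μ ν : Fin D) :
    UniformDecay (fun j => hessKer (A j) 0 (W j)) μ ν (hessW BA 0 BW) (R * N) :=
  uniformDecay_hessKer_halfV (V := fun _ => 0) hA (fun _ => vertexFamilyW_zero N (R / 2) le_rfl) hW hR μ ν

/-- [folklore] **W-HALF, ALL-SCALES LETTER ⟸ WEIGHTED K- AND W-ROWS** (uniform + all-scales; `HessKerSchurCauchy.allScalesRate_hessKer_halfV`). -/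
theorem allScalesRate_halfW (hA : ∀ j, ColW (A j) R BA) (hAall : ∀ k j, ColW (A (k + j) - A k) R (cA * θ ^ k))
    (hW : ∀ j, VertexFamily₂W (W j) N R BW) (hWall : ∀ k j, VertexFamily₂W (W (k + j) - W k) N R (cW * θ ^ k)) (hR : 0 < R)
    (μ ν : Fin D) : AllScalesRate (fun j => hessKer (A j) 0 (W j)) μ ν (lipW BA BA 0 0 BW cA 0 cW) (R * N) θ :=
  allScalesRate_hessKer_halfV (V := fun _ => 0) hA hAall (fun _ => vertexFamilyW_zero N (R / 2) le_rfl)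
    (fun k _ => by rw [sub_self]; exact vertexFamilyW_zero N (R / 2) (by rw [zero_mul])) hW hWall hR μ ν

/-- [folklore] **S-HALF, UNIFORM LETTER ⟸ WEIGHTED K-ROWS AND VERTEX ROWS (L1)** (`uniformDecay_hessKer_halfV` with the table slot `:= 0`). -/
theorem uniformDecay_halfS (hA : ∀ j, ColW (A j) R BA) (hV : ∀ j, VertexFamilyW (V j) N (R / 2) BV) (hR : 0 ≤ R) (μ ν : Fin D) :
    UniformDecay (fun j => hessKer (A j) (V j) 0) μ ν (hessW BA BV 0) (R * N) :=
  uniformDecay_hessKer_halfV (W := fun _ => 0) hA hV (fun _ => vertexFamily₂W_zero N R le_rfl) hR μ ν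

/-- [folklore] **S-HALF, ALL-SCALES LETTER ⟸ WEIGHTED K-ROWS AND VERTEX ROWS (L1)** (uniform + all-scales). -/
theorem allScalesRate_halfS (hA : ∀ j, ColW (A j) R BA) (hAall : ∀ k j, ColW (A (k + j) - A k) R (cA * θ ^ k))
    (hV : ∀ j, VertexFamilyW (V j) N (R / 2) BV) (hVall : ∀ k j, VertexFamilyW (V (k + j) - V k) N (R / 2) (cV * θ ^ k)) (hR : 0 < R)
    (μ ν : Fin D) : AllScalesRate (fun j => hessKer (A j) (V j) 0) μ ν (lipW BA BA BV BV 0 cA cV 0) (R * N) θ :=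
  allScalesRate_hessKer_halfV (W := fun _ => 0) hA hAall hV hVall (fun _ => vertexFamily₂W_zero N R le_rfl)
    (fun k _ => by rw [sub_self]; exact vertexFamily₂W_zero N R (by rw [zero_mul])) hR μ ν

variable {C δK Cv δV Cw δW : ℝ}

/-- [folklore] **W-HALF LETTERS ⟸ ENTRYWISE K-ROWS AND ENTRYWISE W-ROWS (L0, today's binders)** — uniform letter; window `R < δK`, `R < δW`. -/
theorem uniformDecay_halfW_of_entrywise (hA : ∀ j, Decays (A j) C δK) (hW : ∀ j, VertexFamily₂ (W j) N Cw δW) (hR : 0 ≤ R) (hRK : R < δK)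
    (hRW : R < δW) (μ ν : Fin D) :
    UniformDecay (fun j => hessKer (A j) 0 (W j)) μ ν
      (hessW ((Fintype.card F : ℝ) * C * Zl D (δK - R)) 0 ((Fintype.card F : ℝ) ^ 2 * Cw * Zl D (δW - R) ^ 2)) (R * N) :=
  uniformDecay_halfW (fun j => colW_of_decays (hA j) hRK) (fun j => vertexFamily₂W_of_vertexFamily₂ (hW j) hRW) hR μ ν

/-- [folklore] **W-HALF LETTERS ⟸ ENTRYWISE K-ROWS AND ENTRYWISE W-ROWS (L0)** — all-scales letter. -/
theorem allScalesRate_halfW_of_entrywise (hA : ∀ j, Decays (A j) C δK) (hAall : ∀ k j, Decays (A (k + j) - A k) (cA * θ ^ k) δK)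
    (hW : ∀ j, VertexFamily₂ (W j) N Cw δW) (hWall : ∀ k j, VertexFamily₂ (W (k + j) - W k) N (cW * θ ^ k) δW) (hR : 0 < R)
    (hRK : R < δK) (hRW : R < δW) (μ ν : Fin D) :
    AllScalesRate (fun j => hessKer (A j) 0 (W j)) μ ν
      (lipW ((Fintype.card F : ℝ) * C * Zl D (δK - R)) ((Fintype.card F : ℝ) * C * Zl D (δK - R)) 0 0
        ((Fintype.card F : ℝ) ^ 2 * Cw * Zl D (δW - R) ^ 2) ((Fintype.card F : ℝ) * cA * Zl D (δK - R)) 0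
        ((Fintype.card F : ℝ) ^ 2 * cW * Zl D (δW - R) ^ 2)) (R * N) θ :=
  allScalesRate_halfW (fun j => colW_of_decays (hA j) hRK) (fun k j => (colW_of_decays (hAall k j) hRK).mono (le_of_eq (by ring)))
    (fun j => vertexFamily₂W_of_vertexFamily₂ (hW j) hRW)
    (fun k j => (vertexFamily₂W_of_vertexFamily₂ (hWall k j) hRW).mono (le_of_eq (by ring))) hR μ ν

/-- [folklore] **S-HALF LETTERS ⟸ ENTRYWISE K-ROWS AND (UNWEIGHTED) VERTEX ROWS (L1)** — uniform letter; window `R < δK`, `R/2 < δV`. -/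
theorem uniformDecay_halfS_of_vertexRows (hA : ∀ j, Decays (A j) C δK) (hV : ∀ j, VertexFamily (V j) N Cv δV) (hR : 0 ≤ R)
    (hRK : R < δK) (hRV : R / 2 < δV) (μ ν : Fin D) :
    UniformDecay (fun j => hessKer (A j) (V j) 0) μ ν
      (hessW ((Fintype.card F : ℝ) * C * Zl D (δK - R)) ((Fintype.card F : ℝ) ^ 2 * Cv * Zl D (δV - R / 2) ^ 2) 0) (R * N) :=
  uniformDecay_halfS (fun j => colW_of_decays (hA j) hRK) (fun j => vertexFamilyW_of_vertexFamily (hV j) hRV) hR μ ν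

/-- [folklore] **S-HALF LETTERS ⟸ ENTRYWISE K-ROWS AND (UNWEIGHTED) VERTEX ROWS (L1)** — all-scales letter. -/
theorem allScalesRate_halfS_of_vertexRows (hA : ∀ j, Decays (A j) C δK) (hAall : ∀ k j, Decays (A (k + j) - A k) (cA * θ ^ k) δK)
    (hV : ∀ j, VertexFamily (V j) N Cv δV) (hVall : ∀ k j, VertexFamily (V (k + j) - V k) N (cV * θ ^ k) δV) (hR : 0 < R)
    (hRK : R < δK) (hRV : R / 2 < δV) (μ ν : Fin D) :
    AllScalesRate (fun j => hessKer (A j) (V j) 0) μ ν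
      (lipW ((Fintype.card F : ℝ) * C * Zl D (δK - R)) ((Fintype.card F : ℝ) * C * Zl D (δK - R))
        ((Fintype.card F : ℝ) ^ 2 * Cv * Zl D (δV - R / 2) ^ 2) ((Fintype.card F : ℝ) ^ 2 * Cv * Zl D (δV - R / 2) ^ 2) 0
        ((Fintype.card F : ℝ) * cA * Zl D (δK - R)) ((Fintype.card F : ℝ) ^ 2 * cV * Zl D (δV - R / 2) ^ 2) 0) (R * N) θ :=
  allScalesRate_halfS (fun j => colW_of_decays (hA j) hRK) (fun k j => (colW_of_decays (hAall k j) hRK).mono (le_of_eq (by ring)))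
    (fun j => vertexFamilyW_of_vertexFamily (hV j) hRV)
    (fun k j => (vertexFamilyW_of_vertexFamily (hVall k j) hRV).mono (le_of_eq (by ring))) hR μ ν

end Suppliers

section StencilToVertex

variable {d : ℕ} {K : ℕ → MKer (d + 1) (Fib d)} {S : ℕ → Fin (d + 1) → (Fin (d + 1) → ℤ) → MKer (d + 1) (Fib d)}
  {R BK Bs cK cS θ : ℝ}

/-- [folklore] **VERTEX ROWS (L1) ⟸ STENCIL ROWS (L0)** for the assembled vertex `V_j := vertexOfK (K j) N (S j)`: today's entrywise
currency implies the vertex currency (`HessKerSchur.vertexFamilyW_vertexOfK`, `HessKerSchurCauchy.vertexFamilyW_vertexOfK_allScales` BY NAME)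
— so re-typing a slot one rung down RETRACTS NOTHING already filed in the stronger currency. -/
theorem vertexRows_of_stencilRows (hK : ∀ j, ColW (K j) R BK) (hKall : ∀ k j, ColW (K (k + j) - K k) R (cK * θ ^ k))
    (hS : ∀ j, LocStencilW (S j) (R / 2) Bs) (hSall : ∀ k j, LocStencilW (S (k + j) - S k) (R / 2) (cS * θ ^ k)) (hR : 0 < R) (N : ℕ) :
    (∀ j, VertexFamilyW (vertexOfK (K j) N (S j)) N (R / 2) (BK * Bs)) ∧
      ∀ k j, VertexFamilyW (vertexOfK (K (k + j)) N (S (k + j)) - vertexOfK (K k) N (S k)) N (R / 2) ((cK * Bs + BK * cS) * θ ^ k) :=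
  ⟨fun j => vertexFamilyW_vertexOfK (hK j) (hS j) hR N, fun k j => vertexFamilyW_vertexOfK_allScales hK hKall hS hSall hR N k j⟩

end StencilToVertex

section MergeRows

variable {d : ℕ} {V : ℕ → Fin (d + 1) → (Fin (d + 1) → ℤ) → MKer (d + 1) (Fib d)} {N : ℕ} {c θ₁ θ δ : ℝ}

/-- [folklore] A first-order vertex family weakens to a larger constant and a smaller rate (twin of `HessKerConvCKPlug.vertexFamily₂_mono'`). -/
theorem vertexFamily_mono' {V : Fin (d + 1) → (Fin (d + 1) → ℤ) → MKer (d + 1) (Fib d)} {C C' δ δ' : ℝ} (h : VertexFamily V N C δ)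
    (hC0 : 0 ≤ C) (hC : C ≤ C') (hδ : δ' ≤ δ) : VertexFamily V N C' δ' :=
  fun μ y => biLoc_mono' (h μ y) hC0 hC hδ

/-- [folklore] RATE MERGE for first-order vertex-family difference rows: a row at rate `θ₁ ∈ [0, θ]` is a row at rate `θ` (twin of
`HessKerConvCKPlug.vertexFamily₂_rows_rate_le`; for merging vertex rows (L1) with K- and W-rows stated at other rates). -/
theorem vertexFamily_rows_rate_le (h : ∀ k j, VertexFamily (V (k + j) - V k) N (c * θ₁ ^ k) δ) (h0 : 0 ≤ θ₁) (hle : θ₁ ≤ θ) :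
    ∀ k j, VertexFamily (V (k + j) - V k) N (c * θ ^ k) δ := by
  have hc : 0 ≤ c := by simpa using ((h 0 0) 0 0).nonneg (Sum.inl 0)
  exact fun k j => vertexFamily_mono' (h k j) (mul_nonneg hc (pow_nonneg h0 k)) (mul_le_mul_of_nonneg_left (pow_le_pow_left₀ h0 hle k) hc)
    le_rfl

end MergeRows

end Summit.QuantumFields.BalabanUV.Beta.HessKerSlotCurrency

end
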